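import Summits.AtomisticToContinuum.FouriersLaw.Theorems.BondHeatUncertaintyExtensiveSnapshotIrreversibilityEnergyWindowStatements
import Literature.MathematicalPhysics.KineticTheory.LangevinChainNESSHolds

/-!
# Crux `ExtensiveSnapshotIrreversibility` (stmt-AtomisticToContinuum-9121): the ATOMS of the energy-window control `(W)`

Cell decomp-a2c, lens «grading / quantitative ladder», generation 71 (answer to critic row 984 (a):
"propose (B2) ∧ (T1) ∧ (T2o) ∧ (B1w) … without (R) as a typed glue with a first lemma, else (W) stays
a tool").

`(W) = EnergyWindowControl` (`…EnergyWindowStatements.lean`) bundles, behind ONE existential over a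
measurable log-density-ratio family `φ_δ` (`μ_{N,T+δ/2,T−δ/2} = μ_T · e^{φ_δ}`), five clauses: (W0)
the reweighting identity, (T1) a `δ`-uniform exponential energy moment, (T2o) a crude `δ`-uniform
polynomial bound on the ODD part `φ_δ − φ_δ∘Θ`, (B1w) a one-sided `O(δ)` density floor on the energy
window, (B2) `L²(μ_T)` linear response of the density. This file separates them into FIVE GRADED ATOMS,
each a closed `Prop` about the steady-state family ALONE — no shared witness: (T2o)/(B1w) are stated
`μ_T`-almost everywhere and for EVERY measurable reweighting exponent, (B2) through the canonical
Radon–Nikodym derivative `dμ_δ/dμ_T` — so that each atom can be staffed, graded and refuted on its own: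

* `NessGibbsReweighting`   (A0 = W0)  — `μ_δ = μ_T · e^{φ_δ}` for `|δ| < 2T`; THEOREM in the tree
  (`ClausiusBudget.LogDensity.ness_eq_gibbs_withDensity_exp`, file `…NessGibbsReweighting.lean`:
  Hörmander + irreducibility; that module is not yet built on the farm, so it is not imported here);
* `NessExpMomentBound`     (A1 = T1)  — `∫ e^{θH} dμ_δ ≤ C₁` uniformly in `0 < |δ| < δ₀`; its
  integrability half is PROVED below from Cuneo–Eckmann–Hairer–Rey-Bellet 2018 Thm 2.13
  (`CuneoEckmannHairerReyBellet2018_pinnedChain_holds`) and weak-NESS uniqueness; the uniform bound is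
  CEHR Thm 5.1/Rem 5.2 (H2, proved in `LangevinChainH2Proof.lean`) with constants locally uniform in the
  bath temperatures — OPEN (attackable: re-run the H2 shell on a compact temperature rectangle);
* `NessOddLogRatioBound`   (A2 = T2o) — `|φ − φ∘Θ| ≤ C₂(1+H)^k` a.e., `δ`-uniform: a Harnack-chain
  estimate for the hypoelliptic stationary equation (Bony-type Harnack inequality on balls of radius
  `(1+H)^{-s}`, chained from `x` to `Θx`) — OPEN, idea-level;
* `NessDensityFloor`       (A3 = B1w) — `e^{φ} ≥ 1 − C₃|δ|(1+H)^m e^{aH}` a.e., every `a > 0`: a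
  weighted resolvent bound for `L_T^*` on `e^{θH}`-weighted zero-mass measures plus a local hypoelliptic
  sup estimate — OPEN;
* `NessLinearResponseL2`   (A4 = B2)  — `(dμ_δ/dμ_T − 1)/δ → g₀` in `L²(μ_T)`: `L²` linear response of
  the NESS density (the response `g₀` solves `L_T^† g₀ = (γ/2T²)(p_0² − p_{N−1}²)`) — OPEN.

Proved here (no `sorry`, standard axioms):

* `energyWindowControl_of_atoms` — **the glue** `A0 → A1 → A2 → A3 → A4 → (W)`: choose the A0
  exponent, intersect the a.e.-good sets of A2/A3 with their momentum flips (the Gibbs state is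
  flip-invariant, `gibbsMeasure_map_flip`), and redefine `φ_δ := 0` off that flip-symmetric
  `μ_T`-conull set — the pointwise clauses of `(W)` then hold EVERYWHERE, (W0)/(B2) survive the a.e.
  modification (`withDensity_congr_ae`, `Measure.rnDeriv_withDensity`);
* the FIRST RUNGS (the `O(δ)` defect identity of the generator — foot of A3/A4 — and the
  integrability half of A1 from Cuneo–Eckmann–Hairer–Rey-Bellet 2018 Thm 2.13 + weak-NESS uniqueness)
  are in the Literature-only companion file `…EnergyWindowRungs.lean` (checkable and landable now).

References: N. Cuneo, J.-P. Eckmann, M. Hairer, L. Rey-Bellet, EJP 23 (2018) no. 55, Thm 2.13, Thm 5.1,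
Rem 5.2; L. Rey-Bellet, L. E. Thomas, CMP 225 (2002) 305–329; F. Bonetto, J. L. Lebowitz, L. Rey-Bellet,
in: Mathematical Physics 2000, §4.1 eq. (10), §6; M. Hairer, A. J. Majda, Nonlinearity 23 (2010) 909–922
(linear response for hypoelliptic systems, weighted norms); J.-M. Bony, Ann. Inst. Fourier 19 (1969)
277–304 (Harnack inequality for degenerate elliptic operators of Hörmander type).
-/

noncomputable section

namespace Summit.AtomisticToContinuum.FouriersLaw.Theorems.ExtensiveSnapshotIrreversibility.EnergyWindow

open MeasureTheory Filter Topology Real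
open scoped ENNReal NNReal
open Literature.MathematicalPhysics.KineticTheory.HeatConduction
-- landing revision (as in the landed `…EnergyWindowTree` / `…EnergyWindow`): the seat namespace `Tree` of re-proved tree lemmas is gone;
-- the originals are opened instead.
open Summit.AtomisticToContinuum.FouriersLaw.Theorems.ExtensiveSnapshotIrreversibility.Negative
open Summit.AtomisticToContinuum.FouriersLaw.Theorems.ExtensiveSnapshotIrreversibility.ClausiusBudget.OddLogDensity

variable {N : ℕ}

/-! ## 1. The five atoms -/

/-- **A0 `NessGibbsReweighting` (= clause (W0); a THEOREM in the tree,
`ClausiusBudget.LogDensity.ness_eq_gibbs_withDensity_exp`)**: along every steady-state family of the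
pinned chain (weak-NESS uniqueness is carried in the prefix of `(W)` but not used), for `T > 0`,
`N ≥ 2`, there is a family of measurable exponents `φ_δ` with `μ_{N,T+δ/2,T−δ/2} = μ_T · e^{φ_δ}`
for all `|δ| < 2T`. [route statement · this cell; NOT a literature fact] -/
def NessGibbsReweighting : Prop :=
  ∀ ω₂ lam β γ : ℝ, 0 < ω₂ → 0 < lam → 0 < β → 0 < γ →
    (∀ (N : ℕ) (T_L T_R : ℝ), 0 < T_L → 0 < T_R → ∀ μ ν : Measure (PhaseSpace N),
      (pinnedChain ω₂ lam β γ).IsSteadyState N T_L T_R μ →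
      (pinnedChain ω₂ lam β γ).IsSteadyState N T_L T_R ν → μ = ν) →
    ∀ μ : (N : ℕ) → ℝ → ℝ → Measure (PhaseSpace N),
      (∀ (N : ℕ) (T_L T_R : ℝ), 0 < T_L → 0 < T_R →
        (pinnedChain ω₂ lam β γ).IsSteadyState N T_L T_R (μ N T_L T_R)) →
      ∀ T : ℝ, 0 < T → ∀ N : ℕ, 2 ≤ N →
        ∃ φ : ℝ → PhaseSpace N → ℝ, (∀ δ : ℝ, Measurable (φ δ)) ∧
          ∀ δ : ℝ, |δ| < 2 * T →
            μ N (T + δ / 2) (T - δ / 2) =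
              ((pinnedChain ω₂ lam β γ).gibbsMeasure N T).withDensity
                (fun x => ENNReal.ofReal (Real.exp (φ δ x)))

/-- **A1 `NessExpMomentBound` (= clause (T1))**: along every steady-state family (under weak-NESS
uniqueness), for `T > 0`, `N ≥ 2`, there are `δ₀, θ > 0` and `C₁` with `e^{θH} ∈ L¹(μ_{N,T+δ/2,T−δ/2})`
and `∫ e^{θH} dμ_{N,T+δ/2,T−δ/2} ≤ C₁` for all `0 < |δ| < δ₀` (Cuneo–Eckmann–Hairer–Rey-Bellet 2018,
Thm 5.1 / Rem 5.2, with constants locally uniform in the bath temperatures; the integrability is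
`ness_integrable_exp_mul_hamiltonian` below). [route statement · this cell; NOT a literature fact] -/
def NessExpMomentBound : Prop :=
  ∀ ω₂ lam β γ : ℝ, 0 < ω₂ → 0 < lam → 0 < β → 0 < γ →
    (∀ (N : ℕ) (T_L T_R : ℝ), 0 < T_L → 0 < T_R → ∀ μ ν : Measure (PhaseSpace N),
      (pinnedChain ω₂ lam β γ).IsSteadyState N T_L T_R μ →
      (pinnedChain ω₂ lam β γ).IsSteadyState N T_L T_R ν → μ = ν) →
    ∀ μ : (N : ℕ) → ℝ → ℝ → Measure (PhaseSpace N),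
      (∀ (N : ℕ) (T_L T_R : ℝ), 0 < T_L → 0 < T_R →
        (pinnedChain ω₂ lam β γ).IsSteadyState N T_L T_R (μ N T_L T_R)) →
      ∀ T : ℝ, 0 < T → ∀ N : ℕ, 2 ≤ N →
        ∃ δ₀ θ C₁ : ℝ, 0 < δ₀ ∧ 0 < θ ∧
          ∀ δ : ℝ, δ ≠ 0 → |δ| < δ₀ →
            Integrable (fun x => Real.exp (θ * (pinnedChain ω₂ lam β γ).hamiltonian N x))
                (μ N (T + δ / 2) (T - δ / 2)) ∧
              ∫ x, Real.exp (θ * (pinnedChain ω₂ lam β γ).hamiltonian N x)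
                ∂(μ N (T + δ / 2) (T - δ / 2)) ≤ C₁

/-- **A2 `NessOddLogRatioBound` (= clause (T2o), almost-everywhere form)**: along every steady-state
family (under weak-NESS uniqueness), for `T > 0`, `N ≥ 2`, there are `δ₀ > 0`, `C₂`, `k` such that for
`0 < |δ| < δ₀` and EVERY measurable `φ` with `μ_{N,T+δ/2,T−δ/2} = μ_T · e^{φ}`:
`|φ(x) − φ(Θx)| ≤ C₂ (1 + H(x))^k` for `μ_T`-a.e. `x` (a `δ`-uniform Harnack-chain bound on the odd
log-density; no `O(δ)` precision is asked). [route statement · this cell; NOT a literature fact] -/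
def NessOddLogRatioBound : Prop :=
  ∀ ω₂ lam β γ : ℝ, 0 < ω₂ → 0 < lam → 0 < β → 0 < γ →
    (∀ (N : ℕ) (T_L T_R : ℝ), 0 < T_L → 0 < T_R → ∀ μ ν : Measure (PhaseSpace N),
      (pinnedChain ω₂ lam β γ).IsSteadyState N T_L T_R μ →
      (pinnedChain ω₂ lam β γ).IsSteadyState N T_L T_R ν → μ = ν) →
    ∀ μ : (N : ℕ) → ℝ → ℝ → Measure (PhaseSpace N),
      (∀ (N : ℕ) (T_L T_R : ℝ), 0 < T_L → 0 < T_R →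
        (pinnedChain ω₂ lam β γ).IsSteadyState N T_L T_R (μ N T_L T_R)) →
      ∀ T : ℝ, 0 < T → ∀ N : ℕ, 2 ≤ N →
        ∃ δ₀ C₂ : ℝ, ∃ k : ℕ, 0 < δ₀ ∧
          ∀ δ : ℝ, δ ≠ 0 → |δ| < δ₀ →
            ∀ φ : PhaseSpace N → ℝ, Measurable φ →
              μ N (T + δ / 2) (T - δ / 2) =
                ((pinnedChain ω₂ lam β γ).gibbsMeasure N T).withDensity
                  (fun x => ENNReal.ofReal (Real.exp (φ x))) →
              ∀ᵐ x ∂((pinnedChain ω₂ lam β γ).gibbsMeasure N T),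
                |φ x - φ (x.1, -x.2)| ≤ C₂ * (1 + (pinnedChain ω₂ lam β γ).hamiltonian N x) ^ k

/-- **A3 `NessDensityFloor` (= clause (B1w), almost-everywhere form)**: along every steady-state
family (under weak-NESS uniqueness), for `T > 0`, `N ≥ 2` and EVERY slack rate `a > 0`, there are
`δ₀ > 0`, `C₃`, `m` such that for `0 < |δ| < δ₀` and every measurable `φ` with
`μ_{N,T+δ/2,T−δ/2} = μ_T · e^{φ}`: `e^{φ(x)} ≥ 1 − C₃|δ|(1 + H(x))^m e^{aH(x)}` for `μ_T`-a.e. `x`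
(a ONE-sided `O(δ)` floor, informative only on the window `H ≲ a⁻¹ log(1/|δ|)`). [route statement · this cell; NOT a literature fact] -/
def NessDensityFloor : Prop :=
  ∀ ω₂ lam β γ : ℝ, 0 < ω₂ → 0 < lam → 0 < β → 0 < γ →
    (∀ (N : ℕ) (T_L T_R : ℝ), 0 < T_L → 0 < T_R → ∀ μ ν : Measure (PhaseSpace N),
      (pinnedChain ω₂ lam β γ).IsSteadyState N T_L T_R μ →
      (pinnedChain ω₂ lam β γ).IsSteadyState N T_L T_R ν → μ = ν) →
    ∀ μ : (N : ℕ) → ℝ → ℝ → Measure (PhaseSpace N),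
      (∀ (N : ℕ) (T_L T_R : ℝ), 0 < T_L → 0 < T_R →
        (pinnedChain ω₂ lam β γ).IsSteadyState N T_L T_R (μ N T_L T_R)) →
      ∀ T : ℝ, 0 < T → ∀ N : ℕ, 2 ≤ N → ∀ a : ℝ, 0 < a →
        ∃ δ₀ C₃ : ℝ, ∃ m : ℕ, 0 < δ₀ ∧
          ∀ δ : ℝ, δ ≠ 0 → |δ| < δ₀ →
            ∀ φ : PhaseSpace N → ℝ, Measurable φ →
              μ N (T + δ / 2) (T - δ / 2) =
                ((pinnedChain ω₂ lam β γ).gibbsMeasure N T).withDensity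
                  (fun x => ENNReal.ofReal (Real.exp (φ x))) →
              ∀ᵐ x ∂((pinnedChain ω₂ lam β γ).gibbsMeasure N T),
                1 - C₃ * |δ| * (1 + (pinnedChain ω₂ lam β γ).hamiltonian N x) ^ m *
                    Real.exp (a * (pinnedChain ω₂ lam β γ).hamiltonian N x) ≤ Real.exp (φ x)

/-- **A4 `NessLinearResponseL2` (= clause (B2), canonical form)**: along every steady-state family
(under weak-NESS uniqueness), for `T > 0`, `N ≥ 2`, there are `δ₀ > 0` and `g₀ ∈ L²(μ_T)` with
`(dμ_{N,T+δ/2,T−δ/2}/dμ_T − 1)/δ ∈ L²(μ_T)` for `0 < |δ| < δ₀` and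
`∫ ((dμ_{N,T+δ/2,T−δ/2}/dμ_T − 1)/δ − g₀)² dμ_T → 0` as `δ → 0`, `δ ≠ 0` (`L²` linear response of
the NESS density; `dμ_δ/dμ_T` the Radon–Nikodym derivative). [route statement · this cell; NOT a literature fact] -/
def NessLinearResponseL2 : Prop :=
  ∀ ω₂ lam β γ : ℝ, 0 < ω₂ → 0 < lam → 0 < β → 0 < γ →
    (∀ (N : ℕ) (T_L T_R : ℝ), 0 < T_L → 0 < T_R → ∀ μ ν : Measure (PhaseSpace N),
      (pinnedChain ω₂ lam β γ).IsSteadyState N T_L T_R μ →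
      (pinnedChain ω₂ lam β γ).IsSteadyState N T_L T_R ν → μ = ν) →
    ∀ μ : (N : ℕ) → ℝ → ℝ → Measure (PhaseSpace N),
      (∀ (N : ℕ) (T_L T_R : ℝ), 0 < T_L → 0 < T_R →
        (pinnedChain ω₂ lam β γ).IsSteadyState N T_L T_R (μ N T_L T_R)) →
      ∀ T : ℝ, 0 < T → ∀ N : ℕ, 2 ≤ N →
        ∃ δ₀ : ℝ, 0 < δ₀ ∧ ∃ g₀ : PhaseSpace N → ℝ,
          MemLp g₀ 2 ((pinnedChain ω₂ lam β γ).gibbsMeasure N T) ∧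
          (∀ δ : ℝ, δ ≠ 0 → |δ| < δ₀ →
            MemLp (fun x => (((μ N (T + δ / 2) (T - δ / 2)).rnDeriv
                ((pinnedChain ω₂ lam β γ).gibbsMeasure N T) x).toReal - 1) / δ) 2
              ((pinnedChain ω₂ lam β γ).gibbsMeasure N T)) ∧
          Tendsto (fun δ : ℝ => ∫ x, ((((μ N (T + δ / 2) (T - δ / 2)).rnDeriv
                ((pinnedChain ω₂ lam β γ).gibbsMeasure N T) x).toReal - 1) / δ - g₀ x) ^ 2
              ∂(pinnedChain ω₂ lam β γ).gibbsMeasure N T) (𝓝[≠] (0 : ℝ)) (𝓝 0)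

/-! ## 2. The glue: the atoms give `(W)` (flip-symmetrisation of the a.e.-good set) -/

/-- The momentum flip is measurable. [folklore] -/
theorem measurable_flip : Measurable (fun x : PhaseSpace N => (x.1, -x.2)) :=
  measurable_fst.prodMk measurable_snd.neg

/-- **THE GLUE `A0 → A1 → A2 → A3 → A4 → (W)`.** Take the A0 exponent `φ⁰_δ`; with `θ` from A1 put
`a := θ/24` (`12a < θ`); the set `G_δ` where the A2-bound and the A3-floor hold at `x` AND at `Θx` is
measurable, flip-symmetric and (for `0 < |δ| < δ₀`) `μ_T`-conull (A2, A3 and the flip-invariance of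
`μ_T`); `φ_δ := 𝟙_{G_δ} φ⁰_δ` is measurable, equals `φ⁰_δ` a.e. (so (W0), (B2) transfer, the latter via
`dμ_δ/dμ_T = e^{φ_δ}` a.e.), and satisfies (T2o), (B1w) at EVERY point (both sides vanish off `G_δ`).
[folklore] -/
theorem energyWindowControl_of_atoms (h0 : NessGibbsReweighting) (h1 : NessExpMomentBound)
    (h2 : NessOddLogRatioBound) (h3 : NessDensityFloor) (h4 : NessLinearResponseL2) :
    EnergyWindowControl := by
  intro ω₂ lam β γ hω hl hβ hγ hU μ hμ T hT N hN
  -- the data of the atoms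
  obtain ⟨φ₀, hφ₀m, hW0⟩ := h0 ω₂ lam β γ hω hl hβ hγ hU μ hμ T hT N hN
  obtain ⟨δ₁, θ, C₁, hδ₁, hθ, hT1⟩ := h1 ω₂ lam β γ hω hl hβ hγ hU μ hμ T hT N hN
  obtain ⟨δ₂, C₂, k, hδ₂, hT2⟩ := h2 ω₂ lam β γ hω hl hβ hγ hU μ hμ T hT N hN
  have ha : 0 < θ / 24 := by positivity
  obtain ⟨δ₃, C₃, m, hδ₃, hB1⟩ := h3 ω₂ lam β γ hω hl hβ hγ hU μ hμ T hT N hN (θ / 24) ha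
  obtain ⟨δ₄, hδ₄, g₀, hg₀, hB2m, hB2t⟩ := h4 ω₂ lam β γ hω hl hβ hγ hU μ hμ T hT N hN
  -- abbreviations
  set H : PhaseSpace N → ℝ := (pinnedChain ω₂ lam β γ).hamiltonian N
  set μT : Measure (PhaseSpace N) := (pinnedChain ω₂ lam β γ).gibbsMeasure N T with hμTdef
  haveI : IsProbabilityMeasure μT :=
    pinnedChain_isProbabilityMeasure_gibbsMeasure hω hl.le hβ.le γ N hT
  have hH0 : ∀ x : PhaseSpace N, 0 ≤ H x := fun x =>
    pinnedChain_hamiltonian_nonneg hω.le hl.le hβ.le γ N x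
  have hHm : Measurable H :=
    ((pinnedChain ω₂ lam β γ).continuous_hamiltonian
      (pinnedChain_contDiff_U ω₂ lam β γ (n := 0)).continuous
      (pinnedChain_contDiff_V ω₂ lam β γ (n := 0)).continuous N).measurable
  -- the flip is quasi-measure-preserving for `μ_T`
  have hmap : Measure.map (fun x : PhaseSpace N => (x.1, -x.2)) μT = μT := by
    rw [hμTdef]; exact gibbsMeasure_map_flip _ N T
  have hqmp : Measure.QuasiMeasurePreserving (fun x : PhaseSpace N => (x.1, -x.2)) μT μT := by
    refine ⟨measurable_flip, fun s hs => ?_⟩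
    rw [hmap]; exact hs
  -- nonnegative versions of the constants
  set C₂' : ℝ := max C₂ 0
  set C₃' : ℝ := max C₃ 0
  have hC₂'0 : 0 ≤ C₂' := le_max_right _ _
  have hC₃'0 : 0 ≤ C₃' := le_max_right _ _
  -- the radius
  set δ₀ : ℝ := min (min (min δ₁ δ₂) (min δ₃ δ₄)) (2 * T)
  have hδ₀ : 0 < δ₀ := lt_min (lt_min (lt_min hδ₁ hδ₂) (lt_min hδ₃ hδ₄)) (by linarith)
  have hδ₀₁ : δ₀ ≤ δ₁ := (min_le_left _ _).trans ((min_le_left _ _).trans (min_le_left _ _))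
  have hδ₀₂ : δ₀ ≤ δ₂ := (min_le_left _ _).trans ((min_le_left _ _).trans (min_le_right _ _))
  have hδ₀₃ : δ₀ ≤ δ₃ := (min_le_left _ _).trans ((min_le_right _ _).trans (min_le_left _ _))
  have hδ₀₄ : δ₀ ≤ δ₄ := (min_le_left _ _).trans ((min_le_right _ _).trans (min_le_right _ _))
  have hδ₀T : δ₀ ≤ 2 * T := min_le_right _ _
  -- the good sets: the A2-bound and the A3-floor at `x` (set `A δ`) and at `Θ x` (set `G δ`)
  set A : ℝ → Set (PhaseSpace N) := fun δ =>
    {x | |φ₀ δ x - φ₀ δ (x.1, -x.2)| ≤ C₂' * (1 + H x) ^ k} ∩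
      {x | 1 - C₃' * |δ| * (1 + H x) ^ m * Real.exp (θ / 24 * H x) ≤ Real.exp (φ₀ δ x)}
  set G : ℝ → Set (PhaseSpace N) := fun δ =>
    A δ ∩ (fun x : PhaseSpace N => (x.1, -x.2)) ⁻¹' (A δ) with hGdef
  have hAm : ∀ δ, MeasurableSet (A δ) := fun δ => by
    refine (measurableSet_le ?_ ?_).inter (measurableSet_le ?_ ?_)
    · exact continuous_abs.measurable.comp ((hφ₀m δ).sub ((hφ₀m δ).comp measurable_flip))
    · exact measurable_const.mul ((measurable_const.add hHm).pow_const k)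
    · exact measurable_const.sub ((measurable_const.mul
        ((measurable_const.add hHm).pow_const m)).mul ((measurable_const.mul hHm).exp))
    · exact (hφ₀m δ).exp
  have hGm : ∀ δ, MeasurableSet (G δ) := fun δ => (hAm δ).inter (measurable_flip (hAm δ))
  have hGsymm : ∀ δ (x : PhaseSpace N), ((x.1, -x.2) : PhaseSpace N) ∈ G δ ↔ x ∈ G δ := by
    intro δ x
    have hxx : (((x.1, -x.2) : PhaseSpace N).1, -((x.1, -x.2) : PhaseSpace N).2) = x := by simp
    simp only [hGdef, Set.mem_inter_iff, Set.mem_preimage, hxx]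
    exact And.comm
  -- the modified exponent
  set φ : ℝ → PhaseSpace N → ℝ := fun δ => (G δ).indicator (φ₀ δ) with hφdef
  have hφm : ∀ δ, Measurable (φ δ) := fun δ => (hφ₀m δ).indicator (hGm δ)
  have hφ_mem : ∀ δ (x : PhaseSpace N), x ∈ G δ → φ δ x = φ₀ δ x := fun δ x hx => by
    simp [hφdef, hx]
  have hφ_nmem : ∀ δ (x : PhaseSpace N), x ∉ G δ → φ δ x = 0 := fun δ x hx => by
    simp [hφdef, hx]
  -- for `0 < |δ| < δ₀` the good set is conull, so `φ δ = φ₀ δ` a.e.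
  have hW0' : ∀ δ : ℝ, |δ| < δ₀ → μ N (T + δ / 2) (T - δ / 2) =
      μT.withDensity (fun x => ENNReal.ofReal (Real.exp (φ₀ δ x))) := fun δ hδ =>
    hW0 δ (hδ.trans_le hδ₀T)
  have hAae : ∀ δ : ℝ, δ ≠ 0 → |δ| < δ₀ → ∀ᵐ x ∂μT, x ∈ A δ := by
    intro δ hδ hδ'
    have h2 := hT2 δ hδ (hδ'.trans_le hδ₀₂) (φ₀ δ) (hφ₀m δ) (hW0' δ hδ')
    have h3 := hB1 δ hδ (hδ'.trans_le hδ₀₃) (φ₀ δ) (hφ₀m δ) (hW0' δ hδ')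
    filter_upwards [h2, h3] with x hx2 hx3
    have hpk : 0 ≤ (1 + H x) ^ k := pow_nonneg (by linarith [hH0 x]) _
    have hpm : 0 ≤ |δ| * (1 + H x) ^ m * Real.exp (θ / 24 * H x) :=
      mul_nonneg (mul_nonneg (abs_nonneg _) (pow_nonneg (by linarith [hH0 x]) _))
        (Real.exp_pos _).le
    refine ⟨?_, ?_⟩
    · show |φ₀ δ x - φ₀ δ (x.1, -x.2)| ≤ C₂' * (1 + H x) ^ k
      exact hx2.trans (mul_le_mul_of_nonneg_right (le_max_left _ _) hpk)
    · have : C₃ * |δ| * (1 + H x) ^ m * Real.exp (θ / 24 * H x) ≤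
          C₃' * |δ| * (1 + H x) ^ m * Real.exp (θ / 24 * H x) := by
        have e1 : C₃ * |δ| * (1 + H x) ^ m * Real.exp (θ / 24 * H x) =
            C₃ * (|δ| * (1 + H x) ^ m * Real.exp (θ / 24 * H x)) := by ring
        have e2 : C₃' * |δ| * (1 + H x) ^ m * Real.exp (θ / 24 * H x) =
            C₃' * (|δ| * (1 + H x) ^ m * Real.exp (θ / 24 * H x)) := by ring
        rw [e1, e2]
        exact mul_le_mul_of_nonneg_right (le_max_left _ _) hpm
      show 1 - C₃' * |δ| * (1 + H x) ^ m * Real.exp (θ / 24 * H x) ≤ Real.exp (φ₀ δ x)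
      linarith [hx3, this]
  have hGae : ∀ δ : ℝ, δ ≠ 0 → |δ| < δ₀ → ∀ᵐ x ∂μT, x ∈ G δ := by
    intro δ hδ hδ'
    filter_upwards [hAae δ hδ hδ', hqmp.ae (hAae δ hδ hδ')] with x hx hx'
    exact ⟨hx, hx'⟩
  have hφae : ∀ δ : ℝ, δ ≠ 0 → |δ| < δ₀ → φ δ =ᵐ[μT] φ₀ δ := by
    intro δ hδ hδ'
    filter_upwards [hGae δ hδ hδ'] with x hx
    exact hφ_mem δ x hx
  -- (W0) for the modified exponent
  have hW0φ : ∀ δ : ℝ, δ ≠ 0 → |δ| < δ₀ → μ N (T + δ / 2) (T - δ / 2) =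
      μT.withDensity (fun x => ENNReal.ofReal (Real.exp (φ δ x))) := by
    intro δ hδ hδ'
    rw [hW0' δ hδ']
    refine withDensity_congr_ae ?_
    filter_upwards [hφae δ hδ hδ'] with x hx
    rw [hx]
  -- the Radon–Nikodym derivative is `e^{φ δ}` a.e.
  have hrn : ∀ δ : ℝ, δ ≠ 0 → |δ| < δ₀ →
      (fun x => ((((μ N (T + δ / 2) (T - δ / 2)).rnDeriv μT) x).toReal - 1) / δ) =ᵐ[μT]
        fun x => (Real.exp (φ δ x) - 1) / δ := by
    intro δ hδ hδ'
    have hmeas : Measurable fun x => ENNReal.ofReal (Real.exp (φ δ x)) := (hφm δ).exp.ennreal_ofReal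
    have h := Measure.rnDeriv_withDensity μT hmeas
    rw [← hW0φ δ hδ hδ'] at h
    filter_upwards [h] with x hx
    rw [hx, ENNReal.toReal_ofReal (Real.exp_pos _).le]
  -- assemble `(W)`
  refine ⟨δ₀, θ, θ / 24, C₁, C₂', C₃', k, m, hδ₀, hθ, by linarith, φ, g₀, hφm, hW0φ, ?_, ?_, ?_, ?_⟩
  · -- (T1)
    intro δ hδ hδ'
    exact hT1 δ hδ (hδ'.trans_le hδ₀₁)
  · -- (T2o), at every point
    intro δ _ x
    by_cases hx : x ∈ G δ
    · have hx' : ((x.1, -x.2) : PhaseSpace N) ∈ G δ := (hGsymm δ x).2 hx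
      rw [hφ_mem δ x hx, hφ_mem δ _ hx']
      exact hx.1.1
    · have hx' : ((x.1, -x.2) : PhaseSpace N) ∉ G δ := fun h => hx ((hGsymm δ x).1 h)
      rw [hφ_nmem δ x hx, hφ_nmem δ _ hx', sub_self, abs_zero]
      exact mul_nonneg hC₂'0 (pow_nonneg (by linarith [hH0 x]) _)
  · -- (B1w), at every point
    intro δ _ x
    by_cases hx : x ∈ G δ
    · rw [hφ_mem δ x hx]
      exact hx.1.2
    · rw [hφ_nmem δ x hx, Real.exp_zero]
      have : 0 ≤ C₃' * |δ| * (1 + H x) ^ m * Real.exp (θ / 24 * H x) :=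
        mul_nonneg (mul_nonneg (mul_nonneg hC₃'0 (abs_nonneg _))
          (pow_nonneg (by linarith [hH0 x]) _)) (Real.exp_pos _).le
      linarith
  · -- (B2)
    refine ⟨hg₀, fun δ hδ hδ' => ?_, ?_⟩
    · exact (memLp_congr_ae (hrn δ hδ hδ')).1 (hB2m δ hδ (hδ'.trans_le hδ₀₄))
    · refine hB2t.congr' ?_
      filter_upwards [eventually_ne_and_abs_lt hδ₀] with δ hδ
      refine integral_congr_ae ?_
      filter_upwards [hrn δ hδ.1 hδ.2] with x hx
      rw [hx]

end Summit.AtomisticToContinuum.FouriersLaw.Theorems.ExtensiveSnapshotIrreversibility.EnergyWindow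

end
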